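import Summits.BirchSwinnertonDyer.BirchSwinnertonDyer.Theorems.PrintX8SmallImageMuBoundConjA
import Summits.BirchSwinnertonDyer.BirchSwinnertonDyer.Theses.PrintX8
import Summits.BirchSwinnertonDyer.Rank1Residual.Supersingular.X8PrintDischargeOnePrime
import HarnessLib

/-!
# Route `PrintX8`, crux `MuBoundSmallImageX8` (stmt-BirchSwinnertonDyer-20622) BY NAME from Coates–Sujatha's
# statement (A) on the small-image X8 pairs — the GLUE of `PrintX8SmallImageMuBoundConjA.lean` to the route's
# declarations (cell `bsd-print-x8`, D-0131 (2) print tier, prover seat p2 gen 2; `--supports` 20622; imports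
# the route file, like `PrintX8SharpFlatMuTransferGlue.lean`; closes nothing)

PARTITION (cell bsd-print-x8, leaf `ClassX8`; 61 small-image census cells = the domain of 20622): class forms of
the rider-free (A)-road; closes NONE; 0 census cells move; BSD is not proved by any of this.

HONEST FRAMING. The sibling route-independent file proves, per pair and image-free, «(A) at `(W, 3)` ⟹
`μ(X^•) ≤ μ(Λ/(L^•))` for every colour with `L^• ≠ 0`» (`PrintX8MuBoundConjA.X8.muBound_of_conjA`, over
p1 g2's construction fact `Sprung2012.thm714seq_sharpFlatColemanKato_zeta` and the period unit at `3`) and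
the two per-pair supplies of (A) (one class number: Coates–Sujatha Thm. 3.4 + Iwasawa 1956; a `3`-congruent
partner: Lim–Sujatha Prop. 3.2). THIS file quantifies them in the EXACT binder order of the route's `μ`-child
(`Theses/PrintX8.lean` rev 9, item 20622) and composes with the route's glue item 20623
(`GlueMuBoundSmallImageX8`, proved by p3 g1 — taken here BY NAME as a binder, so that this file imports the
route file only):

* `muBoundSmallImageX8_of_conjASmallImage` — **20622 ⟸ (A) on the small-image X8 pairs of rank `≤ 1`**
  («ConjASmallImageX8», an instance of the tree node `FineSelmer.CoatesSujathaConjectureA`; NO K1, NO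
  analytic rider, NO partner);
* `muBoundSmallImageX8_of_coatesSujathaConjectureA` — 20622 ⟸ the tree's general (A) node;
* `muBoundSmallImageX8_of_classicalMuVanishes` — 20622 ⟸ Iwasawa's `μ = 0` for the cyclotomic
  `ℤ₃`-extensions of the `3`-division fields `ℚ(W[3])` of the small-image X8 curves (Coates–Sujatha Thm. 3.4;
  Wuthrich 2006 Prop. 7's «abelian extensions of imaginary quadratic fields» — NOT in print);
* `muBoundSmallImageX8_of_classNumberCertificates` — 20622 ⟸ per pair `3 ∤ h(ℚ(W[3]))` ∧ one prime above
  `3` (the CERTIFICATE form; this seat's kit census in HOME/p2);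
* `muBoundSmallImageX8_of_congruentPartners` — 20622 ⟸ per pair a `3`-congruent partner with (A);
* `sharpFlatMainConjectureSmallImageX8_of_glue_of_K1_of_conjASmallImage` — **20402 ⟸ glue 20623 + K1
  (19875) + (A)-on-small-image + `PublishedInputsX8`**.
READING (planner / tribunal t2): beyond K1 the residual of route `PrintX8` is implied by a NAMED classical
statement, Coates–Sujatha (A) at `p = 3` on the 61 curves (⟸ Iwasawa 1973 `μ = 0` for `ℚ(E[3])`), with a
per-pair certificate road (one class number) — a candidate by-name child «ConjASmallImageX8» (D-0059: the
planner's verb). All theorems CONDITIONAL on the displayed binders; (A) is not asserted. Beyond-print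
theorem: NO. PARTITION: 0 cells.

References: [CoatesSujatha2005] §3 (A), Thm. 3.4; [LimSujatha2018] Prop. 3.2; [Greenberg2001IwasawaPastPresent]
Prop. 2.1; [Wuthrich2006] Prop. 7; [Sprung2012] Thm. 7.14 (3), Prop. 7.19; tree: the sibling file,
`Theses/PrintX8.lean` rev 9 (items 20622/20623), `PrintX8MuGlue.lean` (p3 g1), `PrintX8SharpFlatMuTransferGlue.lean` (p1 g2).
-/

set_option linter.dupNamespace false
set_option autoImplicit false

noncomputable section

open scoped Classical NumberField MatrixGroups ModularForm

open NumberField IsDedekindDomain WeierstrassCurve CongruenceSubgroup Field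
  Literature.NumberTheory.EllipticCurves Literature.NumberTheory.EllipticCurves.ModularForms
  Literature.NumberTheory.EllipticCurves.Rank1Residual
  Literature.NumberTheory.EllipticCurves.Sprung2017 Literature.NumberTheory.EllipticCurves.Sprung2012
  Literature.NumberTheory.EllipticCurves.ZpExtension Literature.NumberTheory.EllipticCurves.IwasawaAlgebra
  Literature.NumberTheory.IwasawaTheory
  Summit.BirchSwinnertonDyer.BirchSwinnertonDyer.Theorems
  Summit.BirchSwinnertonDyer.BirchSwinnertonDyer.Theorems.PrintX8MuBoundConjA
  Summit.BirchSwinnertonDyer.BirchSwinnertonDyer.Theses.PrintX8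

namespace Summit.BirchSwinnertonDyer.BirchSwinnertonDyer.Theorems.PrintX8MuBoundConjAGlue

/-! ### Class forms in the route's binder order (crux 20622 `MuBoundSmallImageX8`, glue 20623) -/

/-- **20622 ⟸ (A) on the small-image X8 pairs of analytic rank `≤ 1`** — the route's `μ`-child
`MuBoundSmallImageX8` BY NAME from statement (A) at `(W, 3)` for every X8 curve `W` with NON-surjective
`ρ̄_{W,3}` and analytic rank `≤ 1`, granted the construction fact `hCK` (p543968) and the period unit at
`3` (`h3`) only: NO K1, NO analytic rider, NO partner. The hypothesis `hA` is the small-image X8 instance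
of the tree node `FineSelmer.CoatesSujathaConjectureA` («ConjASmallImageX8», the planner's split
candidate). CONDITIONAL; closes nothing. [cite: CoatesSujatha2005, §3 statement (A)]
[cite: Sprung2012, Thm. 7.14 (3) (p. 1504) and Prop. 7.19 (p. 1505)] [cite: Kato2004Asterisque, §17.13 (p. 280)] -/
theorem muBoundSmallImageX8_of_conjASmallImage (hCK : thm714seq_sharpFlatColemanKato_zeta)
    (h3 : realPeriodRat_eq_unit_mul_plusPeriod_three)
    (hA : ∀ (W : WeierstrassCurve ℚ) [W.IsElliptic] [W.IsGloballyMinimal] (p : ℕ) [Fact p.Prime],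
      ClassX8 W p → ¬ Surj W p → W.analyticRank ≤ 1 →
        ∀ κ : ZpExtension ℚ p, κ.IsCyclotomic →
          ∃ (γ : absoluteGaloisGroup ℚ) (D : W.FineSelmerDualData κ γ),
            Module.Finite ℤ_[p] (RestrictScalars ℤ_[p] (IwasawaAlgebra p) D.X)) :
    MuBoundSmallImageX8 := by
  intro W _ _ p _ hX hns hr col κ γ hκ hγ hγ' v hv g hg cneg c hH N hN f Lsharp Lflat hf hSP hcol D
  exact X8.muBound_of_conjA W p hCK h3 hX (hA W p hX hns hr) col κ γ hκ hγ hγ' v hv g hg cneg c hH N hN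
    f Lsharp Lflat hf hSP hcol D

/-- **20622 ⟸ Coates–Sujatha's statement (A)** (the tree's general obligation node
`Summit.BirchSwinnertonDyer.Rank1Residual.FineSelmer.CoatesSujathaConjectureA`, OPEN, not asserted),
granted `hCK` and the period unit at `3`. READING for the tribunal (t2): the `μ`-child of route `PrintX8`
is dominated by a NAMED classical statement (Coates–Sujatha 2005 (A) at `p = 3`), itself implied by
Iwasawa's `μ = 0` for the `3`-division fields (next theorem). CONDITIONAL; closes nothing.
[cite: CoatesSujatha2005, §3 statement (A)] [cite: Sprung2012, Prop. 7.19 (p. 1505)] -/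
theorem muBoundSmallImageX8_of_coatesSujathaConjectureA (hCK : thm714seq_sharpFlatColemanKato_zeta)
    (h3 : realPeriodRat_eq_unit_mul_plusPeriod_three)
    (hCSA : Summit.BirchSwinnertonDyer.Rank1Residual.FineSelmer.CoatesSujathaConjectureA) :
    MuBoundSmallImageX8 :=
  muBoundSmallImageX8_of_conjASmallImage hCK h3 fun W _ _ p _ hX _ _ κ hκ ↦ by
    have hp3 : p = 3 := hX.1
    subst hp3
    exact hCSA ℚ W 3 (by decide) κ hκ

/-- **20622 ⟸ Iwasawa's `μ = 0` for the `3`-division fields of the small-image X8 curves**: granted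
`hCK`, the period unit at `3` and Coates–Sujatha 2005 Thm. 3.4 (`hCS`), «for every X8 curve `W` of
analytic rank `≤ 1` with `ρ̄_{W,3}` not surjective, the classical `μ`-invariant of the cyclotomic
`ℤ₃`-extension of `ℚ(W[3])` vanishes» gives the `μ`-child. Those fields have degree 16, Galois group
`SD₁₆`, and are cyclic of degree 8 over an imaginary quadratic field in which `3` is inert — Wuthrich
2006 Prop. 7's «abelian extensions of imaginary quadratic fields», for which Iwasawa's statement is NOT
in print (Ferrero–Washington: fields abelian over `ℚ`). CONDITIONAL; closes nothing.
[cite: CoatesSujatha2005, Thm. 3.4 (§3)] [cite: Wuthrich2006, Prop. 7 (p. 717)]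
[cite: KuriharaPollack2007, §3.1 (chapter p. 26)] -/
theorem muBoundSmallImageX8_of_classicalMuVanishes (hCK : thm714seq_sharpFlatColemanKato_zeta)
    (h3 : realPeriodRat_eq_unit_mul_plusPeriod_three)
    (hCS : CoatesSujatha2005.thm34_fineSelmerDual_moduleFinite_of_classicalMuVanishes_divisionField)
    (hμ : ∀ (W : WeierstrassCurve ℚ) [W.IsElliptic] [W.IsGloballyMinimal],
      ClassX8 W 3 → ¬ Surj W 3 → W.analyticRank ≤ 1 →
        ∀ κL : ZpExtension (W.divisionField 3) 3, κL.IsCyclotomic → ClassicalMuVanishes κL) :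
    MuBoundSmallImageX8 :=
  muBoundSmallImageX8_of_conjASmallImage hCK h3 fun W _ _ p _ hX hns hr κ hκ ↦ by
    have hp3 : p = 3 := hX.1
    subst hp3
    exact hCS W 3 (by decide) (hμ W hX hns hr) κ hκ

/-- **The certificate class form: 20622 ⟸ «every small-image X8 curve of analytic rank `≤ 1` has
`3 ∤ h(ℚ(E[3]))` and exactly one prime of `ℚ(E[3])` above `3`»**, granted `hCK`, the period unit at `3`
and Coates–Sujatha Thm. 3.4; the Iwasawa 1956 step is a tree theorem. Per pair the hypothesis is a finite
certificate (one class number of a degree-16 field; the second clause holds on the whole class, the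
decomposition group at `3` being the full image `N_ns⁺(3)`; census: this seat's kit table in HOME/p2);
CLASS-WIDE it has the strength of Iwasawa's `μ = 0` and is NOT asserted — a `3 ∣ h(ℚ(E[3]))` cell is
not refuted by it, only uncertified. CONDITIONAL; closes nothing.
[cite: CoatesSujatha2005, Thm. 3.4 (§3)] [cite: Greenberg2001IwasawaPastPresent, Prop. 2.1 p. 339] -/
theorem muBoundSmallImageX8_of_classNumberCertificates (hCK : thm714seq_sharpFlatColemanKato_zeta)
    (h3 : realPeriodRat_eq_unit_mul_plusPeriod_three)
    (hCS : CoatesSujatha2005.thm34_fineSelmerDual_moduleFinite_of_classicalMuVanishes_divisionField)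
    (hcert : ∀ (W : WeierstrassCurve ℚ) [W.IsElliptic] [W.IsGloballyMinimal],
      ClassX8 W 3 → ¬ Surj W 3 → W.analyticRank ≤ 1 →
        (haveI : NumberField (W.divisionField 3) := NumberField.mk
         ¬ 3 ∣ NumberField.classNumber (W.divisionField 3)) ∧
        ∃! v : HeightOneSpectrum (𝓞 (W.divisionField 3)),
          ((3 : ℕ) : 𝓞 (W.divisionField 3)) ∈ v.asIdeal) :
    MuBoundSmallImageX8 :=
  muBoundSmallImageX8_of_conjASmallImage hCK h3 fun W _ _ p _ hX hns hr κ hκ ↦ by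
    have hp3 : p = 3 := hX.1
    subst hp3
    obtain ⟨hh, hv⟩ := hcert W hX hns hr
    exact conjA_of_not_dvd_classNumber_of_unique_prime hCS W 3 (by decide) hh hv κ hκ

/-- **The congruence class form: 20622 ⟸ «every small-image X8 curve of analytic rank `≤ 1` has a
`3`-congruent partner `W′` (a `Γ_ℚ`-equivariant `W[3] ≃ W′[3]`) with (A) at `(W′, 3)`»**, granted `hCK`
and the period unit at `3`; the Lim–Sujatha transfer is a tree theorem. Per pair: a congruence
certificate + the partner's (A) (e.g. a CM partner with a signed `μ = 0` reading, K3 c5's 37 cells).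
CONDITIONAL; closes nothing. [cite: LimSujatha2018, §3 Prop. 3.2] [cite: CoatesSujatha2005, §3 statement (A)] -/
theorem muBoundSmallImageX8_of_congruentPartners (hCK : thm714seq_sharpFlatColemanKato_zeta)
    (h3 : realPeriodRat_eq_unit_mul_plusPeriod_three)
    (hpart : ∀ (W : WeierstrassCurve ℚ) [W.IsElliptic] [W.IsGloballyMinimal],
      ClassX8 W 3 → ¬ Surj W 3 → W.analyticRank ≤ 1 →
        ∃ (W' : WeierstrassCurve ℚ) (_ : W'.IsElliptic),
          (∃ e : geomTorsion W (3 : ℤ) ≃+ geomTorsion W' (3 : ℤ),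
            ∀ (σ : absoluteGaloisGroup ℚ) (P : geomTorsion W (3 : ℤ)), e (σ • P) = σ • e P) ∧
          ∀ κ : ZpExtension ℚ 3, κ.IsCyclotomic →
            ∃ (γ : absoluteGaloisGroup ℚ) (D : W'.FineSelmerDualData κ γ),
              Module.Finite ℤ_[3] (RestrictScalars ℤ_[3] (IwasawaAlgebra 3) D.X)) :
    MuBoundSmallImageX8 :=
  muBoundSmallImageX8_of_conjASmallImage hCK h3 fun W _ _ p _ hX hns hr κ hκ ↦ by
    have hp3 : p = 3 := hX.1
    subst hp3
    obtain ⟨W', _, he, hA'⟩ := hpart W hX hns hr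
    exact conjA_of_congruent W W' 3 (by decide) he κ hκ (hA' κ hκ)

/-- **20402 ⟸ glue 20623 + K1 (19875) + (A) on the small-image X8 pairs + `PublishedInputsX8`** — the
route's glue item `GlueMuBoundSmallImageX8 := SprungLowerDivisibilityAtThree → MuBoundSmallImageX8 →
PublishedInputsX8 → SharpFlatMainConjectureSmallImageX8` (PROVED by p3 g1,
`PrintX8MuBoundGlue.glueMuBoundSmallImageX8_holds`; taken here BY NAME as the binder `hGlue` so that this
file stays a leaf over the route file) composed with the first theorem; the period unit at `3` is conjunct 7
of `PublishedInputsX8`. CONDITIONAL; closes nothing.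
[cite: Sprung2012, Thm. 7.14, Thm. 7.16 and Main Conj. 7.21 (pp. 1504–1505)] [cite: CoatesSujatha2005, §3 statement (A)] -/
theorem sharpFlatMainConjectureSmallImageX8_of_glue_of_K1_of_conjASmallImage
    (hGlue : GlueMuBoundSmallImageX8) (hCK : thm714seq_sharpFlatColemanKato_zeta)
    (hK1 : SprungLowerDivisibilityAtThree) (hPub : PublishedInputsX8)
    (hA : ∀ (W : WeierstrassCurve ℚ) [W.IsElliptic] [W.IsGloballyMinimal] (p : ℕ) [Fact p.Prime],
      ClassX8 W p → ¬ Surj W p → W.analyticRank ≤ 1 →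
        ∀ κ : ZpExtension ℚ p, κ.IsCyclotomic →
          ∃ (γ : absoluteGaloisGroup ℚ) (D : W.FineSelmerDualData κ γ),
            Module.Finite ℤ_[p] (RestrictScalars ℤ_[p] (IwasawaAlgebra p) D.X)) :
    SharpFlatMainConjectureSmallImageX8 := by
  have hPub' := hPub
  obtain ⟨-, -, -, -, -, -, h3, -⟩ := hPub'
  exact hGlue hK1 (muBoundSmallImageX8_of_conjASmallImage hCK h3 hA) hPub


end Summit.BirchSwinnertonDyer.BirchSwinnertonDyer.Theorems.PrintX8MuBoundConjAGlue


/-! ## APPEND (p2 g2, 2026-08-27T17:5xZ): the ONE-INTEGER certificate forms, with ty2 g3's discharge of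
«exactly one prime of `ℚ(W[3])` above `3`» on X8 ∩ {¬surj(3)} (`Supersingular/X8PrintDischargeOnePrime.lean`:
`ClassX8.existsUnique_prime_divisionField_of_not_surj`, `ClassX8.classicalMuVanishes_divisionField_of_not_surj_of_not_dvd_classNumber`
— the decomposition group at `3` is the whole image `N_ns⁺(3)`, `e = 8`, `f = 2`, `g = 1`; confirmed numerically on
61/61 cells by kit j283348). The per-pair certificate of the Conj-A road is now literally ONE integer: `h(ℚ(W[3])) mod 3`
(census: `3 ∤ h` on 42 of the 61 cells, 31 of them with `bnfcertify` — HOME/p2/X8-SMALLIMAGE-CLASSNUMBER-j283348.md). -/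

namespace Summit.BirchSwinnertonDyer.BirchSwinnertonDyer.Theorems.PrintX8MuBoundConjAGlue

open Summit.BirchSwinnertonDyer.Rank1Residual.Supersingular

/-- **(A) at `(W, 3)` from ONE INTEGER on X8 ∩ {¬surj(3)}**: for an X8 curve `W` with `ρ̄_{W,3}` NOT onto and
`3 ∤ h(ℚ(W[3]))`, the dual fine Selmer group of `W` over the cyclotomic `ℤ₃`-extension is finitely generated
over `ℤ₃` — Iwasawa 1956 / Greenberg Prop. 2.1 (tree THEOREM) with its «one prime above `3`» hypothesis
DISCHARGED on the class by ty2 g3 (`ClassX8.classicalMuVanishes_divisionField_of_not_surj_of_not_dvd_classNumber`: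
Serre 1972 Prop. 12, decomposition group = image), then Coates–Sujatha 2005 Thm. 3.4 (named fact `hCS`). No local
`3`-torsion condition, no partner, no congruence, no rider. [cite: CoatesSujatha2005, Thm. 3.4 (§3)]
[cite: Greenberg2001IwasawaPastPresent, Prop. 2.1 p. 339] [cite: Serre1972, §1.11 Prop. 12] -/
theorem X8.conjA_of_not_surj_of_not_dvd_classNumber
    (hCS : CoatesSujatha2005.thm34_fineSelmerDual_moduleFinite_of_classicalMuVanishes_divisionField)
    (W : WeierstrassCurve ℚ) [W.IsElliptic] [W.IsGloballyMinimal] (p : ℕ) [Fact p.Prime]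
    (hX : ClassX8 W p) (hns : ¬ Surj W p)
    (hh : haveI : NeZero p := ⟨(Fact.out : p.Prime).ne_zero⟩
      haveI : NumberField (W.divisionField p) := NumberField.mk
      ¬ p ∣ NumberField.classNumber (W.divisionField p))
    (κ : ZpExtension ℚ p) (hκ : κ.IsCyclotomic) :
    ∃ (γ : absoluteGaloisGroup ℚ) (D : W.FineSelmerDualData κ γ),
      Module.Finite ℤ_[p] (RestrictScalars ℤ_[p] (IwasawaAlgebra p) D.X) := by
  have hp2 : p ≠ 2 := by have hp3 : p = 3 := hX.1; subst hp3; decide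
  refine hCS W p hp2 ?_ κ hκ
  intro κL _
  exact ClassX8.classicalMuVanishes_divisionField_of_not_surj_of_not_dvd_classNumber W p hX hns hh κL

/-- **The ONE-INTEGER certificate class form: 20622 ⟸ «every small-image X8 curve of analytic rank `≤ 1` has
`3 ∤ h(ℚ(E[3]))`»**, granted `hCK`, the period unit at `3` and Coates–Sujatha Thm. 3.4 — the `∃!`-clause of
`muBoundSmallImageX8_of_classNumberCertificates` discharged on the class by ty2 g3. Per pair the hypothesis is the
residue of ONE class number mod `3` (kit j283348: `3 ∤ h` on 42/61 cells, 31 unconditional); CLASS-WIDE it has the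
strength of Iwasawa's `μ = 0` for these `SD₁₆` fields and is NOT asserted. CONDITIONAL; closes nothing.
[cite: CoatesSujatha2005, Thm. 3.4 (§3)] [cite: Greenberg2001IwasawaPastPresent, Prop. 2.1 p. 339]
[cite: Sprung2012, Thm. 7.14 (3) (p. 1504) and Prop. 7.19 (p. 1505)] -/
theorem muBoundSmallImageX8_of_classNumbers (hCK : thm714seq_sharpFlatColemanKato_zeta)
    (h3 : realPeriodRat_eq_unit_mul_plusPeriod_three)
    (hCS : CoatesSujatha2005.thm34_fineSelmerDual_moduleFinite_of_classicalMuVanishes_divisionField)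
    (hh : ∀ (W : WeierstrassCurve ℚ) [W.IsElliptic] [W.IsGloballyMinimal],
      ClassX8 W 3 → ¬ Surj W 3 → W.analyticRank ≤ 1 →
        (haveI : NumberField (W.divisionField 3) := NumberField.mk
         ¬ 3 ∣ NumberField.classNumber (W.divisionField 3))) :
    MuBoundSmallImageX8 :=
  muBoundSmallImageX8_of_conjASmallImage hCK h3 fun W _ _ p _ hX hns hr κ hκ ↦ by
    have hp3 : p = 3 := hX.1
    subst hp3
    exact X8.conjA_of_not_surj_of_not_dvd_classNumber hCS W 3 hX hns (hh W hX hns hr) κ hκ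

/-- **20402 ⟸ glue 20623 + K1 (19875) + `PublishedInputsX8` + Coates–Sujatha Thm. 3.4 + «`3 ∤ h(ℚ(E[3]))` on the
small-image X8 curves of rank `≤ 1`»** — the one-integer certificate form composed with the route's glue item
(binder `hGlue`, proved by p3 g1) and K1. CONDITIONAL; closes nothing.
[cite: CoatesSujatha2005, Thm. 3.4 (§3)] [cite: Sprung2012, Thm. 7.14, Thm. 7.16 and Main Conj. 7.21 (pp. 1504–1505)] -/
theorem sharpFlatMainConjectureSmallImageX8_of_glue_of_K1_of_classNumbers
    (hGlue : GlueMuBoundSmallImageX8) (hCK : thm714seq_sharpFlatColemanKato_zeta)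
    (hCS : CoatesSujatha2005.thm34_fineSelmerDual_moduleFinite_of_classicalMuVanishes_divisionField)
    (hK1 : SprungLowerDivisibilityAtThree) (hPub : PublishedInputsX8)
    (hh : ∀ (W : WeierstrassCurve ℚ) [W.IsElliptic] [W.IsGloballyMinimal],
      ClassX8 W 3 → ¬ Surj W 3 → W.analyticRank ≤ 1 →
        (haveI : NumberField (W.divisionField 3) := NumberField.mk
         ¬ 3 ∣ NumberField.classNumber (W.divisionField 3))) :
    SharpFlatMainConjectureSmallImageX8 := by
  have hPub' := hPub
  obtain ⟨-, -, -, -, -, -, h3, -⟩ := hPub'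
  exact hGlue hK1 (muBoundSmallImageX8_of_classNumbers hCK h3 hCS hh) hPub

end Summit.BirchSwinnertonDyer.BirchSwinnertonDyer.Theorems.PrintX8MuBoundConjAGlue

end
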